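import Literature.NumberTheory.LFunctions.XiGaussTiltedMoment
import Mathlib.Analysis.Complex.ExponentialBounds
import HarnessLib

/-!
# The regime `n ≥ 10^{2d+5}` for the all-degree Jensen-polynomial threshold of `ξ`: bookkeeping

Numerical bookkeeping for `JensenXiExponentialRange.lean`. With the
second-moment bound `∫(u-a)²ω ≤ B ∫ω` for the Gauss-tilted weight `ω = Φ(u)uⁿe^{xu²/2}` at its mode `a`
(`XiGaussTiltedMoment.lean`, `x = y/a²`, `y = aL(a) - n`, cut `τ`), this file proves that in the REGIME

  `d ≥ 1`, `n ≥ 10^{2d+5}`, `d + 1 ≤ a ≤ n^{1/4} - 1`, `0 < y ≤ n + 4d + 1 + √(2n(2d+1))`, `τ = 1/8`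

all hypotheses of the second-moment bound hold and `(4d+3) · x · B < 1` (`xiGauss_regime`); the last is
exactly what makes the average of the normal form keep the sign of its value at the test point (the
Lipschitz constant of the normal form is `A√(4d+3)`). The choice `a ≥ d + 1`, `τ = 1/8` gives the main
term `(4d+3)x/ρ ≤ 15/16` through `16πe^{4a} ≥ 4(n+y)/a + 36` and `e^{1/2} ≤ 33/20`; the tail term is
`O((4d+3)/n)`. Also the size facts implied by `n ≥ 10^{2d+5}` (`xiGauss_regime_size`); the bound
`y ≤ n + 4d + 1 + √(2n(2d+1))` is `t₊²` of the oscillatory interval (`laguerreTPlusSq_le`,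
`JensenXiExponentialRange.lean`). Elementary real arithmetic only.

## References
* [GORZPNAS2019] Griffin–Ono–Rolen–Zagier, PNAS 116 (2019), Thm. 3 / §5 (the threshold question).
* [BrascampLieb1976] Brascamp–Lieb, J. Funct. Anal. 22 (1976), Thm. 4.1.
-/

noncomputable section

open Real Set

namespace Literature.NumberTheory.LFunctions

/-! ### Numerical constants -/

/-- `e^{1/2} ≤ 33/20` (since `e ≤ 2.7225 = (33/20)²`). [folklore] -/
private theorem exp_half_le : Real.exp (1 / 2) ≤ 33 / 20 := by
  have h := Real.exp_one_lt_d9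
  have e : Real.exp 1 = Real.exp (1 / 2) ^ 2 := by rw [← Real.exp_nat_mul]; norm_num
  have hpos := Real.exp_pos (1 / 2 : ℝ)
  nlinarith

/-- `e ≤ 2.72 = 68/25`. [folklore] -/
private theorem exp_one_le : Real.exp 1 ≤ 68 / 25 := by
  have := Real.exp_one_lt_d9; linarith

/-- `e^{-t} ≤ 2/t²` for `t > 0` (`t²/2 ≤ eᵗ`). [folklore] -/
private theorem exp_neg_le_two_div_sq {t : ℝ} (ht : 0 < t) : Real.exp (-t) ≤ 2 / t ^ 2 := by
  have h := Real.pow_div_factorial_le_exp t ht.le 2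
  have h2 : ((2 : ℕ).factorial : ℝ) = 2 := by norm_num [Nat.factorial]
  rw [h2] at h
  rw [Real.exp_neg, inv_eq_one_div, div_le_div_iff₀ (Real.exp_pos t) (pow_pos ht 2)]
  linarith

/-! ### Size facts from `n ≥ 10^{2d+5}` -/

/-- **Size facts**: if `d ≥ 1` and `10^{2d+5} ≤ n` then `√n ≥ 300 + 2700d`; in particular
`√n ≥ 512(2d+1)`, `n ≥ 400000(4d+3)`, `n ≥ 10⁷`. [cite: GORZPNAS2019, §5.2] -/
theorem xiGauss_regime_size {n d : ℕ} (hd : 1 ≤ d) (hn : (10 : ℝ) ^ (2 * d + 5) ≤ n) :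
    300 + 2700 * (d : ℝ) ≤ Real.sqrt n ∧ 512 * (2 * (d : ℝ) + 1) ≤ Real.sqrt n ∧
      400000 * (4 * (d : ℝ) + 3) ≤ n ∧ (10 : ℝ) ^ 7 ≤ n := by
  have hd' : (1 : ℝ) ≤ d := by exact_mod_cast hd
  -- `10^{d+2} ≥ 100(1 + 9d)`
  have hB : 1 + (d : ℝ) * 9 ≤ 10 ^ d := by
    have := one_add_mul_le_pow (by norm_num : (-2 : ℝ) ≤ 9) d
    norm_num at this ⊢; linarith
  have h10 : (10 : ℝ) ^ (2 * d + 5) = (10 ^ (d + 2)) ^ 2 * 10 := by ring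
  have h102 : (10 : ℝ) ^ (d + 2) = 10 ^ d * 100 := by rw [pow_add]; norm_num
  have hsq : (300 + 2700 * (d : ℝ)) ^ 2 ≤ n := by
    have h1 : (300 + 2700 * (d : ℝ)) ≤ 3 * 10 ^ (d + 2) := by rw [h102]; linarith
    have h2 : (300 + 2700 * (d : ℝ)) ^ 2 ≤ (3 * 10 ^ (d + 2)) ^ 2 :=
      pow_le_pow_left₀ (by positivity) h1 2
    have h3 : (0 : ℝ) ≤ (10 ^ (d + 2)) ^ 2 := sq_nonneg _
    linarith
  have hs : 300 + 2700 * (d : ℝ) ≤ Real.sqrt n :=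
    (Real.le_sqrt (by positivity) (Nat.cast_nonneg n)).2 hsq
  refine ⟨hs, le_trans (by linarith) hs, le_trans ?_ hsq, le_trans ?_ hn⟩
  · have hdd : (1 : ℝ) * 1 ≤ (d : ℝ) * d := mul_le_mul hd' hd' zero_le_one (by linarith)
    nlinarith
  · calc (10 : ℝ) ^ 7 = 10 ^ (2 * 1 + 5) := by norm_num
      _ ≤ 10 ^ (2 * d + 5) := pow_le_pow_right₀ (by norm_num) (by omega)

/-! ### The three inequalities of the regime, in abstract form -/

/-- `20/33 ≤ e^{-1/2}`. [folklore] -/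
private theorem exp_neg_half_ge : 20 / 33 ≤ Real.exp (-(1 / 2 : ℝ)) := by
  rw [Real.exp_neg, show (20 : ℝ) / 33 = (33 / 20)⁻¹ by norm_num]
  exact inv_anti₀ (Real.exp_pos _) exp_half_le

/-- The left-floor condition from `8Ea ≤ n`: if `2 ≤ a`, `0 ≤ E`, `E a ≤ n/8`, `0 ≤ y ≤ n + E` then
`y (a - 1/8)² ≤ n a²`. [folklore] -/
private theorem regime_c2 {n a y E : ℝ} (ha : 2 ≤ a) (hE0 : 0 ≤ E) (hEa : E * a ≤ n / 8)
    (hy : y ≤ n + E) : y * (a - 1 / 8) ^ 2 ≤ n * a ^ 2 := by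
  have ha0 : 0 < a := by linarith
  have hn0 : 0 ≤ n := by nlinarith
  have step1 : y * (a - 1 / 8) ^ 2 ≤ (n + E) * (a - 1 / 8) ^ 2 :=
    mul_le_mul_of_nonneg_right hy (sq_nonneg _)
  have hEa2 : E * a ^ 2 ≤ n * a / 8 := by
    have := mul_le_mul_of_nonneg_right hEa ha0.le
    have e1 : E * a * a = E * a ^ 2 := by ring
    have e2 : n / 8 * a = n * a / 8 := by ring
    linarith [e1, e2]
  have hb : (n + E) / 64 ≤ (n + E) * a / 8 := by
    rw [div_le_div_iff₀ (by norm_num : (0:ℝ) < 64) (by norm_num : (0:ℝ) < 8)]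
    have := mul_le_mul_of_nonneg_left (show (8 : ℝ) ≤ a * 64 by linarith) (by positivity : (0 : ℝ) ≤ n + E)
    linarith
  have hc : n * a / 8 ≤ (n + E) * a / 8 := by
    have := mul_le_mul_of_nonneg_right (by linarith : n ≤ n + E) ha0.le
    linarith
  have e : (n + E) * (a - 1 / 8) ^ 2 = (n + E) * a ^ 2 - (n + E) * a / 4 + (n + E) / 64 := by ring
  have step2 : (n + E) * (a - 1 / 8) ^ 2 ≤ n * a ^ 2 := by rw [e]; linarith
  exact step1.trans step2

/-- The main term: if `d ≥ 1`, `a ≥ d + 1`, `0 < y ≤ 17n/16`, `ρ > 0` and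
`a²ρ ≥ (80/33) a (n + y) - y`, then `(4d+3)(y/a²)/ρ ≤ 15/16`. [folklore] -/
private theorem regime_main {n a y ρ d : ℝ} (hd : 1 ≤ d) (ha : d + 1 ≤ a) (hy0 : 0 < y)
    (hyn : y ≤ 17 / 16 * n) (hρpos : 0 < ρ) (hρ : 80 / 33 * a * (n + y) - y ≤ a ^ 2 * ρ) :
    (4 * d + 3) * (y / a ^ 2) * (1 / ρ) ≤ 15 / 16 := by
  have ha0 : 0 < a := by linarith
  have hny0 : 0 ≤ n + y := by linarith
  have h1 : (d + 1) * (n + y) ≤ a * (n + y) := mul_le_mul_of_nonneg_right ha hny0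
  have h2 : d * (33 * y) ≤ d * (17 * (n + y)) :=
    mul_le_mul_of_nonneg_left (by linarith) (by linarith)
  have h3 : 0 ≤ d * y := mul_nonneg (by linarith) hy0.le
  have hkey : 16 * (4 * d + 3) * y + 15 * y ≤ 15 * (80 / 33) * (a * (n + y)) := by linarith
  have h4 : 16 * (4 * d + 3) * y ≤ 15 * (a ^ 2 * ρ) := by linarith
  rw [mul_one_div, div_le_div_iff₀ hρpos (by norm_num : (0 : ℝ) < 16)]
  have e : (4 * d + 3) * (y / a ^ 2) * 16 = (16 * (4 * d + 3) * y) / a ^ 2 := by ring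
  rw [e, div_le_iff₀ (pow_pos ha0 2)]
  linarith

/-- The tail term: if `n, a > 0`, `d ≥ 0`, `ρ ≥ (80/33)n/a`, `1 ≤ Λ ≤ 27n/a` and
`n ≥ 400000(4d+3)` (`y ≤ 17n/16`), then `(4d+3)(y/a²) · e^{1/2}√Λ e^{-ρ/128}/(2πρ) < 1/16`.
[folklore] -/
private theorem regime_tail {n a y ρ Λ d : ℝ} (hn : 0 < n) (ha : 0 < a) (hd : 0 ≤ d)
    (hyn : y ≤ 17 / 16 * n) (hρ : 80 / 33 * n / a ≤ ρ) (hΛ1 : 1 ≤ Λ) (hΛ : Λ ≤ 27 * n / a)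
    (hbig : 400000 * (4 * d + 3) ≤ n) :
    (4 * d + 3) * (y / a ^ 2) * (Real.exp (1 / 2) * Real.sqrt Λ *
      Real.exp (-(ρ * (1 / 8) ^ 2 / 2)) / (16 * π * ρ * (1 / 8))) < 1 / 16 := by
  have hna0 : 0 < 80 / 33 * n / a := by positivity
  have hρpos : 0 < ρ := lt_of_lt_of_le hna0 hρ
  have hπ : (3 : ℝ) ≤ π := by have := Real.pi_gt_three; linarith
  have hden : 6 * ρ ≤ 16 * π * ρ * (1 / 8) := by
    have := mul_le_mul_of_nonneg_right hπ hρpos.le; linarith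
  have hexp : Real.exp (-(ρ * (1 / 8) ^ 2 / 2)) ≤ 32768 / ρ ^ 2 := by
    have := exp_neg_le_two_div_sq (by positivity : 0 < ρ * (1 / 8) ^ 2 / 2)
    refine this.trans (le_of_eq ?_)
    field_simp; ring
  have hsqrtΛ : Real.sqrt Λ ≤ Λ := by
    rw [Real.sqrt_le_left (by linarith)]; nlinarith
  have h2e : Real.exp (1 / 2 : ℝ) ≤ 2 := exp_half_le.trans (by norm_num)
  have hnum : Real.exp (1 / 2) * Real.sqrt Λ * Real.exp (-(ρ * (1 / 8) ^ 2 / 2)) ≤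
      2 * (27 * n / a) * (32768 / ρ ^ 2) := by
    have h1 : Real.exp (1 / 2) * Real.sqrt Λ ≤ 2 * (27 * n / a) :=
      mul_le_mul h2e (hsqrtΛ.trans hΛ) (Real.sqrt_nonneg _) (by norm_num)
    exact mul_le_mul h1 hexp (Real.exp_pos _).le (by positivity)
  have hfrac : Real.exp (1 / 2) * Real.sqrt Λ * Real.exp (-(ρ * (1 / 8) ^ 2 / 2)) /
      (16 * π * ρ * (1 / 8)) ≤ (2 * (27 * n / a) * (32768 / ρ ^ 2)) / (6 * ρ) :=
    div_le_div₀ (by positivity) hnum (by positivity) hden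
  have hT4 : (2 * (27 * n / a) * (32768 / ρ ^ 2)) / (6 * ρ) = 294912 * n / (a * ρ ^ 3) := by
    field_simp; ring
  have hρ3 : (80 / 33 * n / a) ^ 3 ≤ ρ ^ 3 := pow_le_pow_left₀ hna0.le hρ 3
  have hT5 : 294912 * n / (a * ρ ^ 3) ≤ 294912 * n / (a * (80 / 33 * n / a) ^ 3) :=
    div_le_div_of_nonneg_left (by positivity) (by positivity) (mul_le_mul_of_nonneg_left hρ3 ha.le)
  have hT6 : 294912 * n / (a * (80 / 33 * n / a) ^ 3) = 294912 * (33 / 80) ^ 3 * a ^ 2 / n ^ 2 := by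
    field_simp
  have hyv : (4 * d + 3) * (y / a ^ 2) ≤ (4 * d + 3) * (17 / 16 * n / a ^ 2) := by
    apply mul_le_mul_of_nonneg_left _ (by positivity)
    exact div_le_div_of_nonneg_right (by linarith) (pow_pos ha 2).le
  have hprod := mul_le_mul hyv ((hfrac.trans (le_of_eq hT4)).trans (hT5.trans (le_of_eq hT6)))
    (by positivity) (by positivity)
  refine lt_of_le_of_lt hprod ?_
  have e : (4 * d + 3) * (17 / 16 * n / a ^ 2) * (294912 * (33 / 80) ^ 3 * a ^ 2 / n ^ 2) =
      ((4 * d + 3) * (17 / 16 * 294912 * (33 / 80) ^ 3)) / n := by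
    field_simp
  rw [e, div_lt_iff₀ hn]
  have hc : (17 : ℝ) / 16 * 294912 * (33 / 80) ^ 3 ≤ 22000 := by norm_num
  have hd3 : (0 : ℝ) ≤ 4 * d + 3 := by positivity
  have := mul_le_mul_of_nonneg_left hc hd3
  linarith

/-- Size consequences for the mode: if `d ≥ 1`, `10^{2d+5} ≤ n`, `2 ≤ a ≤ n^{1/4} - 1`, then
`16(4d+1)a ≤ n`, `16√(2n(2d+1))·a ≤ n` and `37a ≤ n`. [folklore] -/
private theorem regime_aux {n d : ℕ} (hd : 1 ≤ d) (hn : (10 : ℝ) ^ (2 * d + 5) ≤ n) {a : ℝ}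
    (ha2 : 2 ≤ a) (has : a ≤ Real.sqrt (Real.sqrt n) - 1) :
    16 * (4 * (d : ℝ) + 1) * a ≤ n ∧ 16 * Real.sqrt (2 * n * (2 * d + 1)) * a ≤ n ∧ 37 * a ≤ n := by
  obtain ⟨-, hs512, -, hn7⟩ := xiGauss_regime_size hd hn
  have hd' : (1 : ℝ) ≤ d := by exact_mod_cast hd
  have hnpos : (0 : ℝ) < n := lt_of_lt_of_le (by norm_num) hn7
  have ha0 : 0 < a := by linarith
  set r := Real.sqrt (n : ℝ) with hr
  have hr0 : 0 ≤ r := Real.sqrt_nonneg _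
  have hrr : r ^ 2 = n := Real.sq_sqrt hnpos.le
  have hr1536 : (1536 : ℝ) ≤ r := by linarith
  have has' : a ≤ Real.sqrt r := by linarith
  have ha2r : a ^ 2 ≤ r := by
    have := pow_le_pow_left₀ ha0.le has' 2
    rwa [Real.sq_sqrt hr0] at this
  have hrr' : r ≤ r ^ 2 := by
    rw [sq]; exact le_mul_of_one_le_right hr0 (by linarith)
  have har : a ≤ r := has'.trans ((Real.sqrt_le_left hr0).2 hrr')
  set S := Real.sqrt (2 * n * (2 * d + 1)) with hSdef
  have hS0 : 0 ≤ S := Real.sqrt_nonneg _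
  have hSS : S ^ 2 = 2 * n * (2 * d + 1) := Real.sq_sqrt (by positivity)
  have h16d : 16 * (4 * (d : ℝ) + 1) ≤ r := by linarith
  refine ⟨?_, ?_, ?_⟩
  · rw [← hrr, sq]; exact mul_le_mul h16d har ha0.le hr0
  · have h1 : (16 * S * a) ^ 2 ≤ (n : ℝ) ^ 2 := by
      have e : (16 * S * a) ^ 2 = 256 * (2 * n * (2 * d + 1)) * a ^ 2 := by
        rw [mul_pow, mul_pow, hSS]; ring
      rw [e, ← hrr]
      have : 512 * (2 * (d : ℝ) + 1) * a ^ 2 ≤ r * r := mul_le_mul hs512 ha2r (sq_nonneg a) hr0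
      have h2 := mul_le_mul_of_nonneg_right this (sq_nonneg r)
      linarith
    exact (pow_le_pow_iff_left₀ (by positivity) hnpos.le two_ne_zero).1 h1
  · have h1 : 1536 * r ≤ r * r := mul_le_mul_of_nonneg_right hr1536 hr0
    have h2 : r * r = n := by rw [← hrr, sq]
    linarith

/-- The curvature ceiling in the regime: if `2 ≤ a`, `0 < y ≤ 17n/16`, `37a ≤ n` then
`1 ≤ Λ ≤ 27n/a` for `Λ = e(1 + 10⁻⁶)(4(n+y)/a + 36.02) + n/a²`. [folklore] -/
private theorem regime_lam {n a y : ℝ} (ha2 : 2 ≤ a) (hy0 : 0 < y) (hyn : y ≤ 17 / 16 * n)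
    (hna : 37 * a ≤ n) :
    1 ≤ Real.exp 1 * (1 + 1 / 10 ^ 6) * (4 * (n + y) / a + 9005 / 250) + n / a ^ 2 ∧
    Real.exp 1 * (1 + 1 / 10 ^ 6) * (4 * (n + y) / a + 9005 / 250) + n / a ^ 2 ≤ 27 * n / a := by
  have ha0 : 0 < a := by linarith
  have hn0 : 0 ≤ n := by linarith
  have h4 : 0 ≤ 4 * (n + y) / a + 9005 / 250 := by positivity
  constructor
  · have h1 : (1 : ℝ) ≤ Real.exp 1 := by have := Real.add_one_le_exp (1 : ℝ); linarith
    have h2 : 0 ≤ Real.exp 1 * (1 + 1 / 10 ^ 6) * (4 * (n + y) / a) := by positivity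
    have h3 : (0 : ℝ) ≤ n / a ^ 2 := by positivity
    have e : Real.exp 1 * (1 + 1 / 10 ^ 6) * (4 * (n + y) / a + 9005 / 250) =
        Real.exp 1 * (1 + 1 / 10 ^ 6) * (4 * (n + y) / a) +
          Real.exp 1 * ((1 + 1 / 10 ^ 6) * (9005 / 250)) := by ring
    have h5 := mul_le_mul_of_nonneg_right h1 (by norm_num : (0 : ℝ) ≤ (1 + 1 / 10 ^ 6) * (9005 / 250))
    rw [e]
    linarith
  · have h1 : 4 * (n + y) / a + 9005 / 250 ≤ 37 / 4 * (n / a) := by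
      have e1 : 4 * (n + y) / a = (4 * (n + y)) * (1 / a) := by ring
      have e2 : 37 / 4 * (n / a) = (37 / 4 * n) * (1 / a) := by ring
      have e3 : (9005 / 250 : ℝ) = (9005 / 250 * a) * (1 / a) := by field_simp
      rw [e1, e2, e3, ← add_mul]
      exact mul_le_mul_of_nonneg_right (by linarith) (by positivity)
    have h2 : n / a ^ 2 ≤ n / a := by
      rw [div_le_div_iff₀ (pow_pos ha0 2) ha0]
      have hsq : a ≤ a ^ 2 := by rw [sq]; exact le_mul_of_one_le_right ha0.le (by linarith)
      exact mul_le_mul_of_nonneg_left hsq hn0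
    have h3 : Real.exp 1 * (1 + 1 / 10 ^ 6) ≤ 14 / 5 := by
      have := exp_one_le; linarith
    have h5 := mul_le_mul h3 h1 h4 (by norm_num)
    have h6 : (0 : ℝ) ≤ n / a := by positivity
    rw [show (27 : ℝ) * n / a = 27 * (n / a) by ring]
    linarith

/-- The bulk floor in the regime: if `2 ≤ a`, `0 < y`, `0 ≤ n` then
`(80/33) a (n+y) - y ≤ a² ρ` and `(80/33) n/a ≤ ρ` for `ρ = e^{-1/2}(4(n+y)/a + 36) - y/a²`. [folklore] -/
private theorem regime_rho {n a y : ℝ} (ha2 : 2 ≤ a) (hy0 : 0 < y) (hn0 : 0 ≤ n) :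
    80 / 33 * a * (n + y) - y ≤ a ^ 2 * (Real.exp (-(1 / 2)) * (4 * (n + y) / a + 36) - y / a ^ 2) ∧
    80 / 33 * n / a ≤ Real.exp (-(1 / 2)) * (4 * (n + y) / a + 36) - y / a ^ 2 := by
  have ha0 : 0 < a := by linarith
  set ρ := Real.exp (-(1 / 2)) * (4 * (n + y) / a + 36) - y / a ^ 2 with hρ
  have hlow : 80 / 33 * a * (n + y) - y ≤ a ^ 2 * ρ := by
    have h1 : 0 ≤ 4 * (n + y) / a + 36 := by positivity
    have h2 : 20 / 33 * (4 * (n + y) / a + 36) ≤ Real.exp (-(1 / 2)) * (4 * (n + y) / a + 36) :=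
      mul_le_mul_of_nonneg_right exp_neg_half_ge h1
    have h3 := mul_le_mul_of_nonneg_left h2 (pow_pos ha0 2).le
    have e1 : a ^ 2 * (20 / 33 * (4 * (n + y) / a + 36)) = 80 / 33 * a * (n + y) + 720 / 33 * a ^ 2 := by
      field_simp; ring
    have e2 : a ^ 2 * ρ = a ^ 2 * (Real.exp (-(1 / 2)) * (4 * (n + y) / a + 36)) - y := by
      rw [hρ]; field_simp
    rw [e2]
    nlinarith [pow_pos ha0 2]
  refine ⟨hlow, ?_⟩
  have h0 : y ≤ 80 / 33 * a * y := by
    have := mul_le_mul_of_nonneg_right (show (1 : ℝ) ≤ 80 / 33 * a by linarith) hy0.le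
    linarith
  have h1 : a * (80 / 33 * n) ≤ a * (ρ * a) := by
    have e1 : a * (80 / 33 * n) = 80 / 33 * a * (n + y) - 80 / 33 * a * y := by ring
    have e2 : a * (ρ * a) = a ^ 2 * ρ := by ring
    rw [e1, e2]; linarith
  rw [div_le_iff₀ ha0]
  exact le_of_mul_le_mul_left h1 ha0

/-! ### The regime lemma -/

/-- **The regime `n ≥ 10^{2d+5}`.** For `d ≥ 1`, `10^{2d+5} ≤ n`, a mode `a` with `d + 1 ≤ a ≤ n^{1/4} - 1`
and `y = aL(a) - n` with `0 < y ≤ n + 4d + 1 + √(2n(2d+1))`, at the cut `τ = 1/8`: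
the left-floor condition `y(a - 1/8)² ≤ na²` holds, the bulk floor `ρ` is positive, and
`(4d + 3) · x · B < 1` (`x = y/a²`, `B` the second-moment bound of `XiGaussTiltedMoment.lean`).
[cite: BrascampLieb1976, Thm 4.1 (n = 1)] -/
theorem xiGauss_regime {n d : ℕ} (hd : 1 ≤ d) (hn : (10 : ℝ) ^ (2 * d + 5) ≤ n) {a y : ℝ}
    (ha : (d : ℝ) + 1 ≤ a) (has : a ≤ Real.sqrt (Real.sqrt n) - 1) (hy0 : 0 < y)
    (hyE : y ≤ n + (4 * d + 1) + Real.sqrt (2 * n * (2 * d + 1))) (hya : xiGaussY n a = y) :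
    xiGaussY n a * (a - 1 / 8) ^ 2 ≤ n * a ^ 2 ∧ 0 < xiGaussRho n a (1 / 8) ∧
      (4 * d + 3) * xiGaussX n a * xiGaussB n a (1 / 8) < 1 := by
  obtain ⟨-, -, hn3, hn7⟩ := xiGauss_regime_size hd hn
  have hd' : (1 : ℝ) ≤ d := by exact_mod_cast hd
  have hnpos : (0 : ℝ) < n := lt_of_lt_of_le (by norm_num) hn7
  have ha2 : (2 : ℝ) ≤ a := by linarith
  have ha0 : 0 < a := by linarith
  obtain ⟨hEa1, hEa2, hna⟩ := regime_aux hd hn ha2 has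
  have hS0 : 0 ≤ Real.sqrt (2 * n * (2 * d + 1)) := Real.sqrt_nonneg _
  have hSn : 32 * Real.sqrt (2 * n * (2 * d + 1)) ≤ n := by
    have := mul_le_mul_of_nonneg_left ha2 (by positivity : (0 : ℝ) ≤ 16 * Real.sqrt (2 * n * (2 * d + 1)))
    linarith
  have hyn : y ≤ 17 / 16 * n := by linarith
  -- (C2)
  have hC : xiGaussY n a * (a - 1 / 8) ^ 2 ≤ n * a ^ 2 := by
    rw [hya]
    exact regime_c2 (E := (4 * (d : ℝ) + 1) + Real.sqrt (2 * n * (2 * d + 1))) ha2 (by positivity)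
      (by linarith) (by linarith)
  -- the floor
  have hρeq : xiGaussRho n a (1 / 8) = Real.exp (-(1 / 2)) * (4 * (n + y) / a + 36) - y / a ^ 2 := by
    rw [xiGaussRho, hya]; norm_num
  obtain ⟨hρlow, hρlow'⟩ := regime_rho ha2 hy0 hnpos.le
  rw [← hρeq] at hρlow hρlow'
  have hρpos : 0 < xiGaussRho n a (1 / 8) := lt_of_lt_of_le (by positivity) hρlow'
  refine ⟨hC, hρpos, ?_⟩
  -- the ceiling
  have hΛeq : xiGaussLam n a =
      Real.exp 1 * (1 + 1 / 10 ^ 6) * (4 * (n + y) / a + 9005 / 250) + n / a ^ 2 := by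
    rw [xiGaussLam, hya]
  obtain ⟨hΛ1, hΛle⟩ := regime_lam ha2 hy0 hyn hna
  rw [← hΛeq] at hΛ1 hΛle
  have hmain := regime_main hd' ha hy0 hyn hρpos hρlow
  have htail := regime_tail hnpos ha0 (by linarith) hyn hρlow' hΛ1 hΛle hn3
  have hx : xiGaussX n a = y / a ^ 2 := by rw [xiGaussX, hya]
  rw [hx, xiGaussB, mul_add]
  linarith

end Literature.NumberTheory.LFunctions
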